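import Summits.Ventures.HSemireg.ContractionSpanOpSpan
import Mathlib.LinearAlgebra.CliffordAlgebra.Prod
import HarnessLib

/-!
# Venture HSemireg — the PARTIAL Fourier transform `F₂ = id ⊗ E₂ : Λ(V₁ × V₂) ≅ Λ(V₁ × V₂^*)` along one Künneth factor
# and its four intertwining relations with wedge / interior product (part 2 of 3)

HONEST FRAMING. Pure linear algebra in exterior algebras (Mathlib `ExteriorAlgebra` / `CliffordAlgebra`,
`CliffordAlgebra.prodEquiv`, and seat p6's duality map `ContractionSpan.pairDual`), written for the computation cell
`pub-hsemireg` (seat p4). Nothing here is a claim about any variety; nothing here says that HC / HC_CM / HC_AV holds.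
Everything is PROVED; no named fact. New definitions: `zeroProdIso` (the zero form on `V₁ × V₂` is the orthogonal sum of the
zero forms), `tensorEquiv : Λ V₁ ⊗ Λ V₂ ≃ₗ Λ(V₁ × V₂)` (Mathlib's graded-tensor-product equivalence with the grading
forgotten: `a ⊗ c ↦ Λ(inl) a ∧ Λ(inr) c`), `vol b` / `volDual b` (the volume pair of a basis), `fourierEquiv b : Λ V ≃ₗ Λ(V^*)`
(p6's `pairDual eval ω'_b` as an EQUIVALENCE, inverse `pairDual id ω_b`), `partialFourier b₂ : Λ(V₁ × V₂) ≃ₗ Λ(V₁ × V₂^*)`.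

1. `tensorEquiv_tmul`, `prod_induction` (every element of `Λ(V₁ × V₂)` is a sum of `Λ(inl) a ∧ Λ(inr) c`).
2. `fourierEquiv_ι_mul` (`E(v ∧ c) = ι_{ev v} E c`), `fourierEquiv_contractLeft` (`E(ι_θ c) = θ ∧ E c`),
   `partialFourier_map_mul_map` (`F₂(Λ(inl) a ∧ Λ(inr) c) = Λ(inl) a ∧ Λ(inr)(E₂ c)`).
3. THE FOUR INTERTWINING RELATIONS, for every (inhomogeneous) class and with NO Koszul correction:
   `partialFourier_ι_inl_mul` (`F₂` commutes with `(v₁,0) ∧ ·`), `partialFourier_ι_inr_mul` (`(0,v₂) ∧ · ↦ ι_{ev v₂ ∘ pr₂}`),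
   `partialFourier_contractLeft_fst` (`F₂` commutes with `ι_{θ₁∘pr₁}`), `partialFourier_contractLeft_snd`
   (`ι_{θ₂∘pr₂} ↦ (0,θ₂) ∧ ·`) — via part 1's graded Leibniz rules.
4. `partialFourier_box`: a box goes to a box, `F₂(Λ(inl) x₁ ∧ Λ(inr)(a₂ + a₂'ω_b)) = Λ(inl) x₁ ∧ Λ(inr)(a₂ω'_b + a₂')`
   (`E₂ 1 = ω'_b`, `E₂ ω_b = 1`: class-level, `Φ_𝒫` exchanges `1` and the point class).
The rank theorem is part 3 (`ContractionSpanPartialFourierRank.lean`). References: [BourbakiAlgebre1a3] Ch. III §7 no. 7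
Prop. 10, §11 no. 11 Prop. 12; [Mukai1981] Thm. 2.2; [BuchweitzFlenner2008HH] Prop. 6.4.4.
-/

noncomputable section

open CliffordAlgebra (contractLeft)
open ExteriorAlgebra (ι)
open scoped TensorProduct

namespace Summit.Ventures.HSemireg

namespace ContractionSpan

/-! ### 1. The ungraded tensor decomposition `Λ V₁ ⊗ Λ V₂ ≅ Λ(V₁ × V₂)` and the partial Fourier map -/

section Product

universe u

variable {K : Type u} [Field K] {V₁ V₂ : Type u} [AddCommGroup V₁] [Module K V₁] [AddCommGroup V₂] [Module K V₂]

variable (K V₁ V₂) in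
/-- The zero quadratic form on `V₁ × V₂` IS the orthogonal sum of the zero forms (an isometric equivalence along the
identity). [cite: BourbakiAlgebre1a3, Ch. III §7 no. 7] -/
def zeroProdIso :
    ((0 : QuadraticForm K V₁).prod (0 : QuadraticForm K V₂)).IsometryEquiv (0 : QuadraticForm K (V₁ × V₂)) :=
  { LinearEquiv.refl K (V₁ × V₂) with
    map_app' := fun m => by simp [QuadraticMap.prod_apply] }

/-- `zeroProdIso` is the identity on vectors. [cite: BourbakiAlgebre1a3, Ch. III §7 no. 7] -/
@[simp]
theorem zeroProdIso_apply (x : V₁ × V₂) : zeroProdIso K V₁ V₂ x = x := rfl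

/-- `zeroProdIso.toIsometry` is the identity on vectors. [cite: BourbakiAlgebre1a3, Ch. III §7 no. 7] -/
@[simp]
theorem zeroProdIso_toIsometry_apply (x : V₁ × V₂) : (zeroProdIso K V₁ V₂).toIsometry x = x := rfl

variable (K V₁ V₂) in
/-- **`Λ V₁ ⊗ Λ V₂ ≅ Λ(V₁ × V₂)`** as `K`-modules, `a ⊗ c ↦ Λ(inl) a ∧ Λ(inr) c` — Mathlib's graded-tensor-product
equivalence `CliffordAlgebra.prodEquiv` with the grading forgotten. [cite: BourbakiAlgebre1a3, Ch. III §7 no. 7 Prop. 10] -/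
def tensorEquiv : ExteriorAlgebra K V₁ ⊗[K] ExteriorAlgebra K V₂ ≃ₗ[K] ExteriorAlgebra K (V₁ × V₂) :=
  (GradedTensorProduct.of K (CliffordAlgebra.evenOdd (0 : QuadraticForm K V₁))
      (CliffordAlgebra.evenOdd (0 : QuadraticForm K V₂))).trans
    (((CliffordAlgebra.prodEquiv (0 : QuadraticForm K V₁) (0 : QuadraticForm K V₂)).symm.trans
      (CliffordAlgebra.equivOfIsometry (zeroProdIso K V₁ V₂))).toLinearEquiv)

/-- `tensorEquiv (a ⊗ c) = Λ(inl) a ∧ Λ(inr) c`. [cite: BourbakiAlgebre1a3, Ch. III §7 no. 7 Prop. 10] -/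
theorem tensorEquiv_tmul (a : ExteriorAlgebra K V₁) (c : ExteriorAlgebra K V₂) :
    tensorEquiv K V₁ V₂ (a ⊗ₜ c) =
      ExteriorAlgebra.map (LinearMap.inl K V₁ V₂) a * ExteriorAlgebra.map (LinearMap.inr K V₁ V₂) c := by
  have h1 : (CliffordAlgebra.equivOfIsometry (zeroProdIso K V₁ V₂)).toAlgHom.comp
      (CliffordAlgebra.map (QuadraticMap.Isometry.inl (0 : QuadraticForm K V₁) (0 : QuadraticForm K V₂))) =
        ExteriorAlgebra.map (LinearMap.inl K V₁ V₂) := by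
    ext m
    simp
  have h2 : (CliffordAlgebra.equivOfIsometry (zeroProdIso K V₁ V₂)).toAlgHom.comp
      (CliffordAlgebra.map (QuadraticMap.Isometry.inr (0 : QuadraticForm K V₁) (0 : QuadraticForm K V₂))) =
        ExteriorAlgebra.map (LinearMap.inr K V₁ V₂) := by
    ext m
    simp
  change CliffordAlgebra.equivOfIsometry (zeroProdIso K V₁ V₂)
      ((CliffordAlgebra.prodEquiv (0 : QuadraticForm K V₁) (0 : QuadraticForm K V₂)).symm (a ᵍ⊗ₜ c)) = _
  rw [show (CliffordAlgebra.prodEquiv (0 : QuadraticForm K V₁) (0 : QuadraticForm K V₂)).symm (a ᵍ⊗ₜ c) =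
      CliffordAlgebra.toProd _ _ (a ᵍ⊗ₜ c) from rfl, CliffordAlgebra.toProd, GradedTensorProduct.lift_tmul, map_mul,
    ← h1, ← h2]
  rfl

/-- Every element of `Λ(V₁ × V₂)` is reached by `tensorEquiv`: induction principle on sums of `Λ(inl) a ∧ Λ(inr) c`.
[cite: BourbakiAlgebre1a3, Ch. III §7 no. 7 Prop. 10] -/
theorem prod_induction {P : ExteriorAlgebra K (V₁ × V₂) → Prop} (hzero : P 0)
    (htmul : ∀ (a : ExteriorAlgebra K V₁) (c : ExteriorAlgebra K V₂),
      P (ExteriorAlgebra.map (LinearMap.inl K V₁ V₂) a * ExteriorAlgebra.map (LinearMap.inr K V₁ V₂) c))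
    (hadd : ∀ x y, P x → P y → P (x + y)) (x : ExteriorAlgebra K (V₁ × V₂)) : P x := by
  obtain ⟨t, rfl⟩ := (tensorEquiv K V₁ V₂).surjective x
  induction t using TensorProduct.induction_on with
  | zero => rw [map_zero]; exact hzero
  | tmul a c => rw [tensorEquiv_tmul]; exact htmul a c
  | add t t' ht ht' => rw [map_add]; exact hadd _ _ ht ht'

variable {n : ℕ} (b₂ : Module.Basis (Fin n) K V₂)

/-- The volume form `ω_b = b₀ ∧ ⋯ ∧ b_{n-1}` of a basis. [cite: BourbakiAlgebre1a3, Ch. III §7 no. 3] -/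
def vol : ExteriorAlgebra K V₂ := ((List.ofFn b₂).map (ι K)).prod

/-- The dual volume form `ω'_b = b^*_{n-1} ∧ ⋯ ∧ b^*_0`. [cite: BourbakiAlgebre1a3, Ch. III §7 no. 3] -/
def volDual : ExteriorAlgebra K (Module.Dual K V₂) := ((List.ofFn b₂.coord).map (ι K)).reverse.prod

/-- `ω_b` is a top form: `v ∧ ω_b = 0`. [cite: BourbakiAlgebre1a3, Ch. III §7 no. 3 Prop. 6] -/
theorem ι_mul_vol (v : V₂) : ι K v * vol b₂ = 0 := ι_mul_prod_basis_eq_zero b₂ v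

/-- `ω'_b` is a top form: `θ ∧ ω'_b = 0`. [cite: BourbakiAlgebre1a3, Ch. III §7 no. 3 Prop. 6] -/
theorem ι_mul_volDual (θ : Module.Dual K V₂) : ι K θ * volDual b₂ = 0 := ι_mul_prod_coord_reverse_eq_zero b₂ θ

/-- **The Fourier duality `E = pairDual eval ω'_b : Λ V₂ ≅ Λ(V₂^*)`** as a linear EQUIVALENCE (inverse
`pairDual id ω_b`; p6's `pairDual_id_comp_eval` / `pairDual_eval_comp_id` with the unit scalars of the basis volume pair).
[cite: BourbakiAlgebre1a3, Ch. III §11 no. 11 Prop. 12] -/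
def fourierEquiv : ExteriorAlgebra K V₂ ≃ₗ[K] ExteriorAlgebra K (Module.Dual K V₂) :=
  LinearEquiv.ofLinear (pairDual K (Module.Dual.eval K V₂) (volDual b₂))
    (pairDual K (LinearMap.id : Module.Dual K V₂ →ₗ[K] Module.Dual K V₂) (vol b₂))
    (LinearMap.ext fun ξ => by
      rw [LinearMap.comp_apply, LinearMap.id_apply, volDual, vol,
        pairDual_eval_comp_id (ι_mul_prod_coord_reverse_eq_zero b₂)
          (by rw [map_one]; exact pairDual_eval_prod_basis b₂) ξ, one_smul])
    (LinearMap.ext fun x => by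
      rw [LinearMap.comp_apply, LinearMap.id_apply, volDual, vol,
        pairDual_id_comp_eval (ι_mul_prod_basis_eq_zero b₂) (by rw [map_one]; exact pairDual_id_prod_coord b₂) x,
        one_smul])

/-- `fourierEquiv b₂ c = pairDual eval ω'_b c`. [cite: BourbakiAlgebre1a3, Ch. III §11 no. 11] -/
theorem fourierEquiv_apply (c : ExteriorAlgebra K V₂) :
    fourierEquiv b₂ c = pairDual K (Module.Dual.eval K V₂) (volDual b₂) c := rfl

/-- `E(v ∧ c) = ι_{ev v} E(c)` (p6's `pairDual_ι_mul`). [cite: BourbakiAlgebre1a3, Ch. III §11 no. 11 Prop. 12] -/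
theorem fourierEquiv_ι_mul (v : V₂) (c : ExteriorAlgebra K V₂) :
    fourierEquiv b₂ (ι K v * c) = contractLeft (Module.Dual.eval K V₂ v) (fourierEquiv b₂ c) := by
  rw [fourierEquiv_apply, fourierEquiv_apply, pairDual_ι_mul]

/-- `E(ι_θ c) = θ ∧ E(c)` (p6's `pairDual_contractLeft_flip`, `ω'_b` a top form).
[cite: BourbakiAlgebre1a3, Ch. III §11 no. 11 Prop. 12] -/
theorem fourierEquiv_contractLeft (θ : Module.Dual K V₂) (c : ExteriorAlgebra K V₂) :
    fourierEquiv b₂ (contractLeft θ c) = ι K θ * fourierEquiv b₂ c := by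
  rw [fourierEquiv_apply, fourierEquiv_apply, ← flip_eval_apply (K := K) θ,
    pairDual_contractLeft_flip _ (ι_mul_volDual b₂), flip_eval_apply]

/-- **THE PARTIAL FOURIER MAP `F₂ = id ⊗ E₂ : Λ(V₁ × V₂) ≅ Λ(V₁ × V₂^*)`** (Fourier duality along the SECOND factor
only). [cite: BourbakiAlgebre1a3, Ch. III §11 no. 11] [cite: Mukai1981, Thm. 2.2] -/
def partialFourier : ExteriorAlgebra K (V₁ × V₂) ≃ₗ[K] ExteriorAlgebra K (V₁ × Module.Dual K V₂) :=
  (tensorEquiv K V₁ V₂).symm.trans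
    ((TensorProduct.congr (LinearEquiv.refl K (ExteriorAlgebra K V₁)) (fourierEquiv b₂)).trans
      (tensorEquiv K V₁ (Module.Dual K V₂)))

/-- `F₂(Λ(inl) a ∧ Λ(inr) c) = Λ(inl) a ∧ Λ(inr) (E₂ c)`. [cite: BourbakiAlgebre1a3, Ch. III §11 no. 11] -/
theorem partialFourier_map_mul_map (a : ExteriorAlgebra K V₁) (c : ExteriorAlgebra K V₂) :
    partialFourier b₂ (ExteriorAlgebra.map (LinearMap.inl K V₁ V₂) a * ExteriorAlgebra.map (LinearMap.inr K V₁ V₂) c) =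
      ExteriorAlgebra.map (LinearMap.inl K V₁ (Module.Dual K V₂)) a *
        ExteriorAlgebra.map (LinearMap.inr K V₁ (Module.Dual K V₂)) (fourierEquiv b₂ c) := by
  rw [partialFourier, LinearEquiv.trans_apply, LinearEquiv.trans_apply, ← tensorEquiv_tmul, LinearEquiv.symm_apply_apply,
    TensorProduct.congr_tmul, LinearEquiv.refl_apply, tensorEquiv_tmul]

/-! ### 2. The four intertwining relations -/

/-- (W1) `F₂` commutes with `(v₁, 0) ∧ ·`. [cite: BourbakiAlgebre1a3, Ch. III §11 no. 11] -/
theorem partialFourier_ι_inl_mul (v₁ : V₁) (x : ExteriorAlgebra K (V₁ × V₂)) :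
    partialFourier b₂ (ι K ((v₁, 0) : V₁ × V₂) * x) = ι K ((v₁, 0) : V₁ × Module.Dual K V₂) * partialFourier b₂ x := by
  induction x using prod_induction with
  | hzero => rw [mul_zero, map_zero, mul_zero]
  | hadd x y hx hy => rw [mul_add, map_add, hx, hy, map_add, mul_add]
  | htmul a c =>
    have h1 : ι K ((v₁, 0) : V₁ × V₂) = ExteriorAlgebra.map (LinearMap.inl K V₁ V₂) (ι K v₁) := by
      rw [ExteriorAlgebra.map_apply_ι, LinearMap.inl_apply]
    have h2 : ι K ((v₁, 0) : V₁ × Module.Dual K V₂) = ExteriorAlgebra.map (LinearMap.inl K V₁ (Module.Dual K V₂)) (ι K v₁) := by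
      rw [ExteriorAlgebra.map_apply_ι, LinearMap.inl_apply]
    rw [h1, ← mul_assoc, ← map_mul, partialFourier_map_mul_map, partialFourier_map_mul_map, map_mul, ← h2, mul_assoc]

/-- (W2) `F₂` carries `(0, v₂) ∧ ·` to the interior product `ι_{ev v₂ ∘ pr₂}`. [cite: BourbakiAlgebre1a3, Ch. III §11 no. 11 Prop. 12] -/
theorem partialFourier_ι_inr_mul (v₂ : V₂) (x : ExteriorAlgebra K (V₁ × V₂)) :
    partialFourier b₂ (ι K ((0, v₂) : V₁ × V₂) * x) =
      contractLeft ((Module.Dual.eval K V₂ v₂) ∘ₗ LinearMap.snd K V₁ (Module.Dual K V₂)) (partialFourier b₂ x) := by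
  induction x using prod_induction with
  | hzero => rw [mul_zero, map_zero, map_zero]
  | hadd x y hx hy => rw [mul_add, map_add, hx, hy, map_add, map_add]
  | htmul a c =>
    have h1 : ι K ((0, v₂) : V₁ × V₂) = ExteriorAlgebra.map (LinearMap.inr K V₁ V₂) (ι K v₂) := by
      rw [ExteriorAlgebra.map_apply_ι, LinearMap.inr_apply]
    have hkill : ((Module.Dual.eval K V₂ v₂) ∘ₗ LinearMap.snd K V₁ (Module.Dual K V₂)) ∘ₗ
        LinearMap.inl K V₁ (Module.Dual K V₂) = 0 := LinearMap.ext fun _ => by simp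
    have hres : ((Module.Dual.eval K V₂ v₂) ∘ₗ LinearMap.snd K V₁ (Module.Dual K V₂)) ∘ₗ
        LinearMap.inr K V₁ (Module.Dual K V₂) = Module.Dual.eval K V₂ v₂ := LinearMap.ext fun _ => rfl
    rw [← mul_assoc, ι_mul_map_eq, mul_assoc, h1, ← map_mul, partialFourier_map_mul_map, fourierEquiv_ι_mul,
      partialFourier_map_mul_map, contractLeft_map_mul_of_comp_eq_zero _ hkill, contractLeft_map, hres]

/-- (W3) `F₂` commutes with `ι_{θ₁ ∘ pr₁}`. [cite: BourbakiAlgebre1a3, Ch. III §11 no. 9] -/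
theorem partialFourier_contractLeft_fst (θ₁ : Module.Dual K V₁) (x : ExteriorAlgebra K (V₁ × V₂)) :
    partialFourier b₂ (contractLeft (θ₁ ∘ₗ LinearMap.fst K V₁ V₂) x) =
      contractLeft (θ₁ ∘ₗ LinearMap.fst K V₁ (Module.Dual K V₂)) (partialFourier b₂ x) := by
  induction x using prod_induction with
  | hzero => rw [map_zero, map_zero, map_zero]
  | hadd x y hx hy => rw [map_add, map_add, hx, hy, map_add, map_add]
  | htmul a c =>
    have h1 : (θ₁ ∘ₗ LinearMap.fst K V₁ V₂) ∘ₗ LinearMap.inl K V₁ V₂ = θ₁ := LinearMap.ext fun _ => rfl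
    have h1' : (θ₁ ∘ₗ LinearMap.fst K V₁ (Module.Dual K V₂)) ∘ₗ LinearMap.inl K V₁ (Module.Dual K V₂) = θ₁ :=
      LinearMap.ext fun _ => rfl
    have h2 : (θ₁ ∘ₗ LinearMap.fst K V₁ V₂) ∘ₗ LinearMap.inr K V₁ V₂ = 0 := LinearMap.ext fun _ => by simp
    have h2' : (θ₁ ∘ₗ LinearMap.fst K V₁ (Module.Dual K V₂)) ∘ₗ LinearMap.inr K V₁ (Module.Dual K V₂) = 0 :=
      LinearMap.ext fun _ => by simp
    rw [contractLeft_map_mul, h1, contractLeft_map, h2, map_zero, LinearMap.zero_apply, map_zero, mul_zero, add_zero,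
      partialFourier_map_mul_map, partialFourier_map_mul_map, contractLeft_map_mul, h1', contractLeft_map, h2', map_zero,
      LinearMap.zero_apply, map_zero, mul_zero, add_zero]

/-- (W4) `F₂` carries `ι_{θ₂ ∘ pr₂}` to `(0, θ₂) ∧ ·`. [cite: BourbakiAlgebre1a3, Ch. III §11 no. 11 Prop. 12] -/
theorem partialFourier_contractLeft_snd (θ₂ : Module.Dual K V₂) (x : ExteriorAlgebra K (V₁ × V₂)) :
    partialFourier b₂ (contractLeft (θ₂ ∘ₗ LinearMap.snd K V₁ V₂) x) =
      ι K ((0, θ₂) : V₁ × Module.Dual K V₂) * partialFourier b₂ x := by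
  induction x using prod_induction with
  | hzero => rw [map_zero, map_zero, mul_zero]
  | hadd x y hx hy => rw [map_add, map_add, hx, hy, map_add, mul_add]
  | htmul a c =>
    have hkill : (θ₂ ∘ₗ LinearMap.snd K V₁ V₂) ∘ₗ LinearMap.inl K V₁ V₂ = 0 := LinearMap.ext fun _ => by simp
    have hres : (θ₂ ∘ₗ LinearMap.snd K V₁ V₂) ∘ₗ LinearMap.inr K V₁ V₂ = θ₂ := LinearMap.ext fun _ => rfl
    have h2 : ι K ((0, θ₂) : V₁ × Module.Dual K V₂) =
        ExteriorAlgebra.map (LinearMap.inr K V₁ (Module.Dual K V₂)) (ι K θ₂) := by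
      rw [ExteriorAlgebra.map_apply_ι, LinearMap.inr_apply]
    rw [contractLeft_map_mul_of_comp_eq_zero _ hkill, contractLeft_map, hres, partialFourier_map_mul_map,
      fourierEquiv_contractLeft, partialFourier_map_mul_map, ← mul_assoc, ι_mul_map_eq, mul_assoc, h2, ← map_mul]

end Product

/-! ### 3. Boxes go to boxes -/

section Box

universe u

variable {K : Type u} [Field K] {V₁ V₂ : Type u} [AddCommGroup V₁] [Module K V₁] [AddCommGroup V₂] [Module K V₂]
variable {n : ℕ} (b₂ : Module.Basis (Fin n) K V₂)


/-- `E₂ 1 = ω'_b` and `E₂ ω_b = 1`. [cite: BourbakiAlgebre1a3, Ch. III §11 no. 11 Prop. 12] -/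
theorem fourierEquiv_one_and_vol : fourierEquiv b₂ 1 = volDual b₂ ∧ fourierEquiv b₂ (vol b₂) = 1 :=
  ⟨by rw [fourierEquiv_apply, pairDual_one], by rw [fourierEquiv_apply, volDual, vol]; exact pairDual_eval_prod_basis b₂⟩

/-- **A box goes to a box**: `F₂(Λ(inl) x₁ ∧ Λ(inr)(a₂ + a₂'·ω_b)) = Λ(inl) x₁ ∧ Λ(inr)(a₂·ω'_b + a₂')` — the second factor's
«scalar + top form» is again «top form + scalar» (class-level: `Φ_𝒫` exchanges `1` and the point class).
[cite: Mukai1981, Thm. 2.2] [cite: BourbakiAlgebre1a3, Ch. III §11 no. 11 Prop. 12] -/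
theorem partialFourier_box (x₁ : ExteriorAlgebra K V₁) (a₂ a₂' : K) :
    partialFourier b₂ (ExteriorAlgebra.map (LinearMap.inl K V₁ V₂) x₁ *
        ExteriorAlgebra.map (LinearMap.inr K V₁ V₂) (algebraMap K _ a₂ + a₂' • vol b₂)) =
      ExteriorAlgebra.map (LinearMap.inl K V₁ (Module.Dual K V₂)) x₁ *
        ExteriorAlgebra.map (LinearMap.inr K V₁ (Module.Dual K V₂)) (a₂ • volDual b₂ + algebraMap K _ a₂') := by
  rw [partialFourier_map_mul_map, map_add, map_smul, (fourierEquiv_one_and_vol b₂).2, Algebra.algebraMap_eq_smul_one,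
    map_smul, (fourierEquiv_one_and_vol b₂).1, Algebra.algebraMap_eq_smul_one]

end Box

end ContractionSpan

end Summit.Ventures.HSemireg

end
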